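import Summits.Ventures.PercRepro.RankLevelSetDepCountHeavyB

/-!
# PercRepro — THE HEAVY / LIGHT SPLIT OF THE `U`-COUNT, PART C: THE ASSEMBLED COUNT (p8, S3)

`proofs/SUBCLAIM-S3-p8.md` §3f. **`ncard_eRk_eq_ncard_le_le_heavy`** (in `ℚ`): for a finite matroid of corank `d`
whose circuits have `≥ 3` elements, with `σ(a) = Σ_{j ≤ d − q − 1} C(a, j)/(j + 1)`,
`#{B ⊆ E : r(B) = q, |B| ≤ d} ≤ C(n, q) + σ(min(f′ − q, ν₁ − 2))·#(light small pairs) + σ(ν₁ − 2)·#(light big pairs)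
  + #{heavy rank-q sets}`,
the light big pairs being ABSENT when `q + ν₁ ≤ f′ + 2` (`card_pairsBigLight_eq_zero`), every pair class being at most
`#pairsF ≤ Σ_k s_k·C(n, q + 1 − k)` (`card_pairsF_le`), and the heavy sets at most `2^{|UG|} + (n + 1)·2^{|UH|}`
(`ncard_heavy_le`, part B). Axioms: standard.
-/

open scoped Matroid

namespace PercRepro

namespace Matroid

open Set Finset

variable {α : Type} {M : _root_.Matroid α}

open scoped Classical in
/-- **The level-`m` count of the light sets**, the light pairs split at the small closure (`≤ f′ + 1` points). -/
theorem mul_card_levelLight_le [M.Finite] (q f' ν₁ : ℕ) (hcirc : ∀ C, M.IsCircuit C → 3 ≤ C.encard) (m : ℕ) :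
    (m - q) * (levelLight M q ν₁ m).card ≤
      ((pairsLight M q ν₁).filter (fun p => p ∈ pairsSmall M q f')).card *
          (min (f' - q) (ν₁ - 2)).choose (m - (q + 1)) +
        ((pairsLight M q ν₁).filter (fun p => p ∉ pairsSmall M q f')).card * (ν₁ - 2).choose (m - (q + 1)) := by
  have hsplit : ∑ p ∈ pairsLight M q ν₁, (fibreLevel M q p m).card =
      ∑ p ∈ (pairsLight M q ν₁).filter (fun p => p ∈ pairsSmall M q f'), (fibreLevel M q p m).card +
        ∑ p ∈ (pairsLight M q ν₁).filter (fun p => p ∉ pairsSmall M q f'), (fibreLevel M q p m).card :=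
    (Finset.sum_filter_add_sum_filter_not (pairsLight M q ν₁) _ _).symm
  calc (m - q) * (levelLight M q ν₁ m).card ≤ ∑ p ∈ pairsLight M q ν₁, (fibreLevel M q p m).card :=
        mul_card_levelLight_le_sum q ν₁ hcirc m
    _ = _ := hsplit
    _ ≤ ∑ _p ∈ (pairsLight M q ν₁).filter (fun p => p ∈ pairsSmall M q f'),
          (min (f' - q) (ν₁ - 2)).choose (m - (q + 1)) +
          ∑ _p ∈ (pairsLight M q ν₁).filter (fun p => p ∉ pairsSmall M q f'), (ν₁ - 2).choose (m - (q + 1)) :=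
        add_le_add
          (Finset.sum_le_sum (fun p hp => by
            rw [Finset.mem_filter] at hp
            exact card_fibreLevel_light_small q f' ν₁ hp.1 hp.2 m))
          (Finset.sum_le_sum (fun p hp => by
            rw [Finset.mem_filter] at hp
            exact card_fibreLevel_light q ν₁ hp.1 m))
    _ = _ := by rw [Finset.sum_const, smul_eq_mul, Finset.sum_const, smul_eq_mul]

open scoped Classical in
/-- **No light big pair when `q + ν₁ ≤ f′ + 2`**: a big closure has `≥ f′ + 2 ≥ q + ν₁` points. -/
theorem card_pairsBigLight_eq_zero [M.Finite] (q f' ν₁ : ℕ) (h : q + ν₁ ≤ f' + 2) :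
    ((pairsLight M q ν₁).filter (fun p => p ∉ pairsSmall M q f')).card = 0 := by
  rw [Finset.card_eq_zero, Finset.filter_eq_empty_iff]
  intro p hp hns
  unfold pairsLight at hp
  rw [Finset.mem_filter] at hp
  apply hns
  unfold pairsSmall
  rw [Finset.mem_filter]
  exact ⟨hp.1, by omega⟩

open scoped Classical in
/-- The light small pairs are pairs. -/
theorem card_pairsLightSmall_le [M.Finite] (q f' ν₁ : ℕ) :
    ((pairsLight M q ν₁).filter (fun p => p ∈ pairsSmall M q f')).card ≤ (pairsF M q).card :=
  (Finset.card_filter_le _ _).trans (Finset.card_filter_le _ _)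

open scoped Classical in
/-- The light big pairs are pairs. -/
theorem card_pairsBigLight_le [M.Finite] (q f' ν₁ : ℕ) :
    ((pairsLight M q ν₁).filter (fun p => p ∉ pairsSmall M q f')).card ≤ (pairsF M q).card :=
  (Finset.card_filter_le _ _).trans (Finset.card_filter_le _ _)

open scoped Classical in
/-- **The heavy levels are covered by the heavy sets.** -/
theorem sum_card_levelHeavy_le [M.Finite] (q ν₁ d : ℕ) :
    ∑ m ∈ Finset.Icc (q + 1) d, (levelHeavy M q ν₁ m).card ≤
      {B : Set α | B ⊆ M.E ∧ M.eRk B = (q : ℕ∞) ∧ q + ν₁ ≤ (M.closure B).ncard}.ncard := by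
  set T := (Finset.Icc (q + 1) d).biUnion (fun m => levelHeavy M q ν₁ m) with hT
  have hdisj : ∀ m ∈ Finset.Icc (q + 1) d, ∀ m' ∈ Finset.Icc (q + 1) d, m ≠ m' →
      Disjoint (levelHeavy M q ν₁ m) (levelHeavy M q ν₁ m') := by
    intro m _ m' _ hmm'
    rw [Finset.disjoint_left]
    intro B hB hB'
    unfold levelHeavy at hB hB'
    rw [Finset.mem_filter] at hB hB'
    have h1 := (mem_levelF.1 hB.1).2.1
    have h2 := (mem_levelF.1 hB'.1).2.1
    omega
  rw [← Finset.card_biUnion hdisj, ← hT]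
  have hfin : {B : Set α | B ⊆ M.E ∧ M.eRk B = (q : ℕ∞) ∧ q + ν₁ ≤ (M.closure B).ncard}.Finite :=
    M.ground_finite.finite_subsets.subset (fun B hB => hB.1)
  calc T.card = (T.image (fun s : Finset α => (s : Set α))).card :=
        (Finset.card_image_of_injective _ Finset.coe_injective).symm
    _ = ((T.image (fun s : Finset α => (s : Set α)) : Finset (Set α)) : Set (Set α)).ncard :=
        (Set.ncard_coe_finset _).symm
    _ ≤ _ := by
        apply ncard_le_ncard _ hfin
        intro B hB
        rw [Finset.mem_coe, Finset.mem_image] at hB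
        obtain ⟨s, hs, rfl⟩ := hB
        rw [hT, Finset.mem_biUnion] at hs
        obtain ⟨m, _, hsm⟩ := hs
        unfold levelHeavy at hsm
        rw [Finset.mem_filter] at hsm
        obtain ⟨hsl, hheavy⟩ := hsm
        obtain ⟨hsg, -, hsq⟩ := mem_levelF.1 hsl
        refine ⟨?_, hsq, hheavy⟩
        rw [← coe_groundF]
        exact_mod_cast hsg

open scoped Classical in
/-- **The `U`-count with the heavy / light split**, in `ℚ`:
`#{B ⊆ E : r(B) = q, |B| ≤ d} ≤ C(n, q) + σ(min(f′ − q, ν₁ − 2))·#(light small pairs) + σ(ν₁ − 2)·#(light big pairs)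
  + #{heavy sets}`, `σ(a) = Σ_{j ≤ d − q − 1} C(a, j)/(j + 1)`. -/
theorem ncard_eRk_eq_ncard_le_le_heavy (M : _root_.Matroid α) [M.Finite] (q f' ν₁ : ℕ)
    (hcirc : ∀ C, M.IsCircuit C → 3 ≤ C.encard) (d : ℕ) :
    ({B : Set α | B ⊆ M.E ∧ M.eRk B = q ∧ B.ncard ≤ d}.ncard : ℚ) ≤
      (M.E.ncard.choose q : ℚ) +
        (∑ j ∈ Finset.range (d - (q + 1) + 1), ((min (f' - q) (ν₁ - 2)).choose j : ℚ) / (j + 1)) *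
          (((pairsLight M q ν₁).filter (fun p => p ∈ pairsSmall M q f')).card : ℚ) +
        (∑ j ∈ Finset.range (d - (q + 1) + 1), ((ν₁ - 2).choose j : ℚ) / (j + 1)) *
          (((pairsLight M q ν₁).filter (fun p => p ∉ pairsSmall M q f')).card : ℚ) +
        ({B : Set α | B ⊆ M.E ∧ M.eRk B = (q : ℕ∞) ∧ q + ν₁ ≤ (M.closure B).ncard}.ncard : ℚ) := by
  set Ef := groundF M with hEf
  have hE : (Ef : Set α) = M.E := coe_groundF M
  have hEcard : Ef.card = M.E.ncard := card_groundF M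
  set S := {B : Set α | B ⊆ M.E ∧ M.eRk B = q ∧ B.ncard ≤ d} with hS
  set S₁ := {B : Set α | B ⊆ (Ef : Set α) ∧ B.ncard = q} with hS₁
  set S₂ := {B : Set α | B ⊆ M.E ∧ M.eRk B = q ∧ q < B.ncard ∧ B.ncard ≤ d} with hS₂
  set Hv := {B : Set α | B ⊆ M.E ∧ M.eRk B = (q : ℕ∞) ∧ q + ν₁ ≤ (M.closure B).ncard} with hHv
  set Ps := ((pairsLight M q ν₁).filter (fun p => p ∈ pairsSmall M q f')).card with hPs
  set Pb := ((pairsLight M q ν₁).filter (fun p => p ∉ pairsSmall M q f')).card with hPb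
  have hsplit : S ⊆ S₁ ∪ S₂ := by
    intro B hB
    have hBfin : B.Finite := M.ground_finite.subset hB.1
    have hle : q ≤ B.ncard := by
      have := M.eRk_le_encard B
      rw [hB.2.1, ← hBfin.cast_ncard_eq] at this
      exact_mod_cast this
    rcases hle.lt_or_eq with h | h
    · exact Or.inr ⟨hB.1, hB.2.1, h, hB.2.2⟩
    · exact Or.inl ⟨by rw [hE]; exact hB.1, h.symm⟩
  have hS₁fin : S₁.Finite := (Ef.finite_toSet.finite_subsets).subset (fun B hB => hB.1)
  have hS₂fin : S₂.Finite := M.ground_finite.finite_subsets.subset (fun B hB => hB.1)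
  have hS₁ : S₁.ncard = M.E.ncard.choose q := by
    rw [hS₁, ncard_subsets_ncard_eq Ef q, hEcard]
  -- the light levels
  have hlevel : ∀ m ∈ Finset.Icc (q + 1) d, ((levelLight M q ν₁ m).card : ℚ) ≤
      ((Ps : ℚ) * ((min (f' - q) (ν₁ - 2)).choose (m - (q + 1)) : ℚ) +
        (Pb : ℚ) * ((ν₁ - 2).choose (m - (q + 1)) : ℚ)) / ((m - q : ℕ) : ℚ) := by
    intro m hm
    rw [Finset.mem_Icc] at hm
    have hpos : (0 : ℚ) < ((m - q : ℕ) : ℚ) := by exact_mod_cast (by omega : 0 < m - q)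
    rw [le_div_iff₀ hpos]
    have h := mul_card_levelLight_le q f' ν₁ hcirc m
    have h' : (((m - q) * (levelLight M q ν₁ m).card : ℕ) : ℚ) ≤
        ((Ps * (min (f' - q) (ν₁ - 2)).choose (m - (q + 1)) + Pb * (ν₁ - 2).choose (m - (q + 1)) : ℕ) : ℚ) := by
      exact_mod_cast h
    push_cast at h'
    linarith
  -- the levels
  have hS₂q : (S₂.ncard : ℚ) ≤ ∑ m ∈ Finset.Icc (q + 1) d,
      ((Ps : ℚ) * ((min (f' - q) (ν₁ - 2)).choose (m - (q + 1)) : ℚ) +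
        (Pb : ℚ) * ((ν₁ - 2).choose (m - (q + 1)) : ℚ)) / ((m - q : ℕ) : ℚ) + (Hv.ncard : ℚ) := by
    have h3' : ∑ m ∈ Finset.Icc (q + 1) d, (levelHeavy M q ν₁ m).card ≤ Hv.ncard := by
      rw [hHv]
      exact sum_card_levelHeavy_le q ν₁ d
    have h3q : ((∑ m ∈ Finset.Icc (q + 1) d, (levelHeavy M q ν₁ m).card : ℕ) : ℚ) ≤ (Hv.ncard : ℚ) := by
      exact_mod_cast h3'
    have h2 : ∑ m ∈ Finset.Icc (q + 1) d, (levelF M q m).card =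
        ∑ m ∈ Finset.Icc (q + 1) d, (levelLight M q ν₁ m).card +
          ∑ m ∈ Finset.Icc (q + 1) d, (levelHeavy M q ν₁ m).card := by
      rw [← Finset.sum_add_distrib]
      exact Finset.sum_congr rfl (fun m _ => card_levelF_eq_light_add_heavy q ν₁ m)
    calc (S₂.ncard : ℚ) ≤ ((∑ m ∈ Finset.Icc (q + 1) d, (levelF M q m).card : ℕ) : ℚ) := by
          exact_mod_cast ncard_dep_le_sum_levelF q d
      _ = ∑ m ∈ Finset.Icc (q + 1) d, ((levelLight M q ν₁ m).card : ℚ) +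
            ((∑ m ∈ Finset.Icc (q + 1) d, (levelHeavy M q ν₁ m).card : ℕ) : ℚ) := by
          rw [h2]
          push_cast
          rfl
      _ ≤ _ := add_le_add (Finset.sum_le_sum hlevel) h3q
  -- re-index the level sums
  have hre : ∑ m ∈ Finset.Icc (q + 1) d,
      ((Ps : ℚ) * ((min (f' - q) (ν₁ - 2)).choose (m - (q + 1)) : ℚ) +
        (Pb : ℚ) * ((ν₁ - 2).choose (m - (q + 1)) : ℚ)) / ((m - q : ℕ) : ℚ) =
      ∑ j ∈ Finset.range (d - q),
        ((Ps : ℚ) * ((min (f' - q) (ν₁ - 2)).choose j : ℚ) / ((j : ℚ) + 1) +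
          (Pb : ℚ) * ((ν₁ - 2).choose j : ℚ) / ((j : ℚ) + 1)) := by
    rw [show Finset.Icc (q + 1) d = Finset.image (fun j => q + 1 + j) (Finset.range (d - q)) from ?_]
    · rw [Finset.sum_image (fun a _ b _ h => by omega)]
      apply Finset.sum_congr rfl
      intro j _
      rw [show q + 1 + j - (q + 1) = j by omega, show q + 1 + j - q = j + 1 by omega]
      push_cast
      ring
    · ext m
      rw [Finset.mem_Icc, Finset.mem_image]
      constructor
      · intro hm
        exact ⟨m - (q + 1), by rw [Finset.mem_range]; omega, by omega⟩
      · rintro ⟨j, hj, rfl⟩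
        rw [Finset.mem_range] at hj
        omega
  have hrange : Finset.range (d - q) ⊆ Finset.range (d - (q + 1) + 1) := Finset.range_mono (by omega)
  have hS₂q' : (S₂.ncard : ℚ) ≤
      (∑ j ∈ Finset.range (d - (q + 1) + 1), ((min (f' - q) (ν₁ - 2)).choose j : ℚ) / (j + 1)) * (Ps : ℚ) +
        (∑ j ∈ Finset.range (d - (q + 1) + 1), ((ν₁ - 2).choose j : ℚ) / (j + 1)) * (Pb : ℚ) +
        (Hv.ncard : ℚ) := by
    rw [Finset.sum_mul, Finset.sum_mul]
    refine hS₂q.trans (add_le_add (hre.le.trans ?_) (le_refl _))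
    rw [Finset.sum_add_distrib]
    apply add_le_add
    · refine (Finset.sum_le_sum_of_subset_of_nonneg hrange (fun j _ _ => by positivity)).trans' ?_
      apply le_of_eq
      apply Finset.sum_congr rfl
      intro j _
      ring
    · refine (Finset.sum_le_sum_of_subset_of_nonneg hrange (fun j _ _ => by positivity)).trans' ?_
      apply le_of_eq
      apply Finset.sum_congr rfl
      intro j _
      ring
  have hSq : (S.ncard : ℚ) ≤ (S₁.ncard : ℚ) + (S₂.ncard : ℚ) := by
    have : S.ncard ≤ S₁.ncard + S₂.ncard :=
      (ncard_le_ncard hsplit (hS₁fin.union hS₂fin)).trans (ncard_union_le _ _)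
    exact_mod_cast this
  rw [hS₁] at hSq
  linarith

end Matroid

end PercRepro
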